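import Summits.HodgeConjecture.CorCM.IrreducibleOddWeightsRightIdealsGaloisPartner
import HarnessLib

/-!
# Right ideals, IX: a nondegenerate Galois HUB — around a member `A₁` with CM by a Galois field `K₁ ↪ K_i` (all `i`) and a
# nondegenerate type, the defect of the family is the SUM of the Hecke ranks of the shadows of the other members

COR-CM (cell `pub-hodgecm2`, binder seat `b16` gen 64, count-neutral claim RIGHT IDEALS, file R9 — CM fields; theorems only,
no definition, no named fact, no `sorry`).  NEW as stated, hence under `Summits/`.  HONEST FRAMING: an exact formula for
`Σ_i dim Hg(A_i) − dim Hg(∏_i A_i)` for families of abelian varieties with complex multiplication sharing a Galois CM field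
carried by one nondegenerate member; `HC_CM` is neither used nor asserted.

SETTING (R5b, R8).  CM fields `K_i` (`i ∈ I`), CM types `Φ_i`; a HUB `i₁`: `K_{i₁}` Galois, `Φ_{i₁}` nondegenerate, embeddings
`j_i : K_{i₁} → K_i` (`j_{i₁} = id`), `z₀ : K_{i₁} → ℂ`; shadows `w_i(z) = 2·#{t ∈ Φ_i : t|_{K_{i₁}} = z} − [K_i:K_{i₁}]` and Hecke
modules `H_i = span{w_i(· ∘ δ)} = w_iℚ[Gal(K_{i₁}/ℚ)]`.  Hypothesis (GL) of R5b (each Galois closure meets the compositum of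
the others inside `z₀(K_{i₁})`; automatic at the hub).

* **`sum_cmTypeRank_add_one_eq_of_isNondegenerate_hub`** — `Σ_i cmTypeRank Φ_i + 1 = cmFamilyRank Φ + |I| + Σ_{i ≠ i₁} dim H_i`:
  **`Σ_i dim Hg(A_i) − dim Hg(∏_i A_i) = Σ_{i ≠ hub} dim(w_iℚ[Gal(K_{i₁}/ℚ)])`** — the defects of the members against the hub
  (R8: each is `dim H_i`) simply ADD UP.  (R5b gives the defect as `Σ_i dim H_i − dim Σ_i H_i`; the hub's module is all of
  `Anti(Hom(K_{i₁}, ℂ))` (R8), which contains every `H_i` (shadows are odd, R7) and has dimension `[K_{i₁}:ℚ]/2 = dim H_{i₁}`.)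
* **`sum_cmTypeRank_add_one_eq_of_finrank_eq_two_hub`** — hub `E_k` (`[k:ℚ] = 2`, every type nondegenerate):
  **`Σ_i dim Hg(A_i) − dim Hg(E_k × ∏_{i≠hub} A_i) = #{i ≠ hub : W_i ≠ 0}`**, the number of members with non-zero signature
  defect on `k` — Moonen–Zarhin's `A × E` summed over the family (R7's count `#{i : W_i ≠ 0} − 1` with the hub's `W = ±1`).

## References

* [Kubota1965] T. Kubota, *On the field extension by complex multiplication*, Trans. AMS 118 (1965), §2 Lemma 1, §4 Lemma 2.
* [Gordon1999HodgeAVSurvey] B. B. Gordon, *A survey of the Hodge conjecture for abelian varieties*, §3 Theorem (proof),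
  7.5–7.7, 9.4.3.
* [MoonenZarhin1999LowDim] B. Moonen, Yu. Zarhin, *Hodge classes on abelian varieties of low dimension*, Thm. (0.1) (a), §3.
* [Shimura1998] G. Shimura, *Abelian Varieties with Complex Multiplication and Modular Functions*, §8.1, §32.10.
-/

set_option autoImplicit false

noncomputable section

open scoped BigOperators Classical

open CategoryTheory CategoryTheory.Limits NumberField NumberField.ComplexEmbedding Module IntermediateField

namespace Summit.HodgeConjecture.CorCM

open Literature.NumberTheory.ComplexMultiplication
open Literature.AlgebraicGeometry.Motives (AbelianVariety CMType)
open Literature.AlgebraicGeometry.Pohlmann1968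

variable {I : Type} [Fintype I] {K : I → Type} [∀ i, Field (K i)] [∀ i, NumberField (K i)] [∀ i, IsCMField (K i)]

omit [Fintype I] in
/-- `dim Anti(Hom(K, ℂ)) = [K:ℚ]/2` as soon as `K` carries a nondegenerate type. [cite: Kubota1965, §2 Lemma 1] -/
theorem finrank_antiWeights_eq_of_isNondegenerate {i₁ : I} (Ψ : CMType (K i₁)) (hnd : IsNondegenerate Ψ) :
    Module.finrank ℚ (antiWeights (E := K i₁ →+* ℂ) (starRingAut : ℂ ≃+* ℂ)) = finrank ℚ (K i₁) / 2 := by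
  have h := finrank_antiWeights_eq_of_typeRank_eq (isCMTypeWith_conj Ψ)
    (by rw [Embeddings.card]; exact hnd)
  rwa [Embeddings.card] at h

omit [Fintype I] in
/-- **Around a nondegenerate Galois hub the sum of the Hecke modules is all of `Anti`**, of dimension `[K_{i₁}:ℚ]/2`.
[cite: Kubota1965, §2 Lemma 1] [cite: Shimura1998, §32.10] -/
theorem finrank_iSup_span_precomp_shadow_eq_of_isNondegenerate_hub {i₁ : I} [IsGalois ℚ (K i₁)] (Φ : ∀ i, CMType (K i))
    (hnd : IsNondegenerate (Φ i₁)) (j : ∀ i, K i₁ →+* K i) (hj : j i₁ = RingHom.id (K i₁)) :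
    Module.finrank ℚ (⨆ i, Submodule.span ℚ (Set.range fun δ : K i₁ ≃ₐ[ℚ] K i₁ => fun z : K i₁ →+* ℂ =>
        ∑ t ∈ Finset.univ.filter (fun t : K i →+* ℂ => t.comp (j i) = z.comp (δ : K i₁ →+* K i₁)),
          antiVec (Φ i).1 (1 : ℂ ≃+* ℂ) t) : Submodule ℚ ((K i₁ →+* ℂ) → ℚ)) = finrank ℚ (K i₁) / 2 := by
  have hsup : (⨆ i, Submodule.span ℚ (Set.range fun δ : K i₁ ≃ₐ[ℚ] K i₁ => fun z : K i₁ →+* ℂ =>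
      ∑ t ∈ Finset.univ.filter (fun t : K i →+* ℂ => t.comp (j i) = z.comp (δ : K i₁ →+* K i₁)),
        antiVec (Φ i).1 (1 : ℂ ≃+* ℂ) t) : Submodule ℚ ((K i₁ →+* ℂ) → ℚ)) =
      antiWeights (E := K i₁ →+* ℂ) (starRingAut : ℂ ≃+* ℂ) := by
    apply le_antisymm (iSup_le fun i => span_precomp_shadow_le_antiWeights (Φ i) (j i))
    have h1 := span_precomp_shadow_id_eq_antiWeights (Φ i₁) hnd
    rw [← hj] at h1
    rw [← h1]
    exact le_iSup (fun i => Submodule.span ℚ (Set.range fun δ : K i₁ ≃ₐ[ℚ] K i₁ => fun z : K i₁ →+* ℂ =>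
      ∑ t ∈ Finset.univ.filter (fun t : K i →+* ℂ => t.comp (j i) = z.comp (δ : K i₁ →+* K i₁)),
        antiVec (Φ i).1 (1 : ℂ ≃+* ℂ) t)) i₁
  rw [hsup, finrank_antiWeights_eq_of_isNondegenerate (Φ i₁) hnd]

omit [Fintype I] in
/-- The hub's own Hecke module is `Anti`, of dimension `[K_{i₁}:ℚ]/2`. [cite: Kubota1965, §2 Lemma 1] -/
theorem finrank_span_precomp_shadow_hub_eq {i₁ : I} [IsGalois ℚ (K i₁)] (Φ : ∀ i, CMType (K i))
    (hnd : IsNondegenerate (Φ i₁)) (j : ∀ i, K i₁ →+* K i) (hj : j i₁ = RingHom.id (K i₁)) :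
    Module.finrank ℚ (Submodule.span ℚ (Set.range fun δ : K i₁ ≃ₐ[ℚ] K i₁ => fun z : K i₁ →+* ℂ =>
        ∑ t ∈ Finset.univ.filter (fun t : K i₁ →+* ℂ => t.comp (j i₁) = z.comp (δ : K i₁ →+* K i₁)),
          antiVec (Φ i₁).1 (1 : ℂ ≃+* ℂ) t)) = finrank ℚ (K i₁) / 2 := by
  rw [hj, span_precomp_shadow_id_eq_antiWeights (Φ i₁) hnd, finrank_antiWeights_eq_of_isNondegenerate (Φ i₁) hnd]

/-- **A NONDEGENERATE GALOIS HUB: THE DEFECTS ADD UP.**  `K_{i₁}` Galois with `Φ_{i₁}` nondegenerate, `j_i : K_{i₁} → K_i`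
(`j_{i₁} = id`), `z₀ : K_{i₁} → ℂ`, (GL).  Then `Σ_i cmTypeRank Φ_i + 1 = cmFamilyRank Φ + |I| + Σ_{i ≠ i₁} dim H_i`, i.e.
**`Σ_i dim Hg(A_i) − dim Hg(∏_i A_i) = Σ_{i ≠ i₁} dim(w_iℚ[Gal(K_{i₁}/ℚ)])`** — the sum over the other members of their exact
drops against the hub (R8). [cite: Kubota1965, §2 Lemma 1 and §4 Lemma 2] [cite: Gordon1999HodgeAVSurvey, §3 Theorem (proof), 7.5–7.7 and 9.4.3] -/
theorem sum_cmTypeRank_add_one_eq_of_isNondegenerate_hub {i₁ : I} [IsGalois ℚ (K i₁)] (Φ : ∀ i, CMType (K i))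
    (hnd : IsNondegenerate (Φ i₁)) (j : ∀ i, K i₁ →+* K i) (hj : j i₁ = RingHom.id (K i₁)) (z₀ : K i₁ →+* ℂ)
    (hmeet : ∀ (l : I) (z : ℂ), z ∈ normalClosure ℚ (K l) ℂ →
      z ∈ (⨆ i : {i : I // i ≠ l}, normalClosure ℚ (K i.1) ℂ) → z ∈ Set.range z₀) :
    (∑ i, cmTypeRank (Φ i)) + 1 = CMAlgebra.cmFamilyRank Φ + Fintype.card I +
      ∑ i ∈ Finset.univ.erase i₁, Module.finrank ℚ (Submodule.span ℚ (Set.range fun δ : K i₁ ≃ₐ[ℚ] K i₁ =>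
        fun z : K i₁ →+* ℂ => ∑ t ∈ Finset.univ.filter (fun t : K i →+* ℂ => t.comp (j i) = z.comp (δ : K i₁ →+* K i₁)),
          antiVec (Φ i).1 (1 : ℂ ≃+* ℂ) t)) := by
  haveI : Nonempty I := ⟨i₁⟩
  have h := sum_cmTypeRank_add_one_add_finrank_iSup_eq Φ j z₀ hmeet
  rw [finrank_iSup_span_precomp_shadow_eq_of_isNondegenerate_hub Φ hnd j hj,
    ← Finset.add_sum_erase Finset.univ (fun i => Module.finrank ℚ (Submodule.span ℚ (Set.range
      fun δ : K i₁ ≃ₐ[ℚ] K i₁ => fun z : K i₁ →+* ℂ => ∑ t ∈ Finset.univ.filter (fun t : K i →+* ℂ =>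
        t.comp (j i) = z.comp (δ : K i₁ →+* K i₁)), antiVec (Φ i).1 (1 : ℂ ≃+* ℂ) t))) (Finset.mem_univ i₁),
    finrank_span_precomp_shadow_hub_eq Φ hnd j hj] at h
  omega

/-- **HUB `E_k`** (`[k:ℚ] = 2`; every CM type of `k` is nondegenerate): under (GL),
`Σ_i cmTypeRank Φ_i + 1 = cmFamilyRank Φ + |I| + #{i ≠ i₁ : W_i ≠ 0}` with `W_i = Σ_{t | t∘j_i = z₀} u_1(Φ_i)(t)` the signature
defects: **`Σ_i dim Hg(A_i) − dim Hg(E_k × ∏_{i≠i₁} A_i) = #{i ≠ i₁ : d_i ≠ 0}`** — one dimension per member of non-zero signature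
defect on `k`. [cite: MoonenZarhin1999LowDim, Thm. (0.1) (a) and §3] [cite: Gordon1999HodgeAVSurvey, 7.5–7.7 and 9.4.3] -/
theorem sum_cmTypeRank_add_one_eq_of_finrank_eq_two_hub {i₁ : I} (hk : finrank ℚ (K i₁) = 2) (Φ : ∀ i, CMType (K i))
    (j : ∀ i, K i₁ →+* K i) (hj : j i₁ = RingHom.id (K i₁)) (z₀ : K i₁ →+* ℂ)
    (hmeet : ∀ (l : I) (z : ℂ), z ∈ normalClosure ℚ (K l) ℂ →
      z ∈ (⨆ i : {i : I // i ≠ l}, normalClosure ℚ (K i.1) ℂ) → z ∈ Set.range z₀) :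
    (∑ i, cmTypeRank (Φ i)) + 1 = CMAlgebra.cmFamilyRank Φ + Fintype.card I +
      ((Finset.univ.erase i₁).filter fun i => ∑ t ∈ Finset.univ.filter (fun t : K i →+* ℂ => t.comp (j i) = z₀),
        antiVec (Φ i).1 (1 : ℂ ≃+* ℂ) t ≠ 0).card := by
  haveI := isGalois_of_finrank_eq_two hk
  have h := sum_cmTypeRank_add_one_eq_of_isNondegenerate_hub Φ (isNondegenerate_of_finrank_eq_two (Φ i₁) hk) j hj z₀
    hmeet
  rw [Finset.sum_congr rfl fun i _ => finrank_span_precomp_shadow_eq hk (Φ i) (j i) z₀, Finset.sum_ite,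
    Finset.sum_const_zero, zero_add, Finset.sum_const, smul_eq_mul, mul_one] at h
  convert h using 3

end Summit.HodgeConjecture.CorCM

end
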